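import Mathlib
import HarnessLib

/-!
# Rules of Gauss type for an odd weighting function (Davis–Rabinowitz 1984, Sect. 2.7.6)

Davis–Rabinowitz, *Methods of Numerical Integration* (2nd ed., 1984), Sect. 2.7.6 "Rules of Gauss Type
for Weighting Functions of Mixed Sign", second case: a weighting function `w` that is **odd** on `[-a, a]`,
`w (-x) = -w x`.  The text derives a `2M`-point rule with weights of mixed sign that is exact on `𝒫_{4M}`
from an `M`-point rule of Gauss type for the nonnegative weight `u ↦ w (√u)` on `[0, a²]`:

* (2.7.6.2) the substitution `u = x²`:  `∫_{-a}^{a} x w(x) g(x²) dx = ∫_0^{a²} w(√u) g(u) du`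
  (`integral_mul_oddWeight_comp_sq`; hypotheses: `w`, `g` continuous, `w` odd, `0 ≤ a`);
* (2.7.6.3) odd powers: `∫_{-a}^{a} w(x) x^{2r+1} dx = ∫_0^{a²} w(√u) u^r du` and hence `= Σ_j W_j u_j^r`
  whenever the rule `(u_j, W_j)_{j<M}` integrates `u^r` exactly (`integral_oddWeight_mul_pow_odd`);
* (2.7.6.4) even powers come "free": `∫_{-a}^{a} w(x) x^{2r} dx = 0` (`integral_oddWeight_mul_pow_even`,
  oddness only);
* (2.7.6.5)–(2.7.6.6) the rule with the `2M` nodes `x_j^* = √u_j`, `x_{j+M}^* = -√u_j` and weights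
  `w_j^* = W_j / (2 √u_j)`, `w_{j+M}^* = -w_j^*` (`oddExtensionRule`), its value on even / odd monomials
  (`oddExtensionRule_pow_even`, `oddExtensionRule_pow_odd`), its linearity, and the exactness theorem
  `integral_oddWeight_mul_eval_eq_oddExtensionRule`: if the `M`-point rule integrates `u^r` against
  `w(√u)` on `[0, a²]` for `r ≤ 2M - 1`, then `∫_{-a}^{a} w p = oddExtensionRule M u W p` for every real
  polynomial `p` of degree `≤ 4M`.
* A worked instance (`oddExtensionRule_linearWeight_*`): `w(x) = x` on `[-1, 1]`, `M = 1`, `u₁ = 3/5`,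
  `W₁ = 2/3` (the one-point Gauss rule for `√u` on `[0, 1]`): the two-point rule reproduces
  `∫_{-1}^{1} x · x dx = 2/3` and `∫_{-1}^{1} x · x³ dx = 2/5`.

The first case of Sect. 2.7.6 ((2.7.6.1), Kronrod–Stieltjes) is not formalised here.
All statements are over `ℝ` with the interval integral of Mathlib; no `sorry`, standard axioms.
-/

noncomputable section

open Polynomial Finset MeasureTheory intervalIntegral

namespace Literature.Analysis.Quadrature

/-! ### Symmetric-interval integrals of odd and even integrands (folklore) -/

/-- [folklore] An odd integrand integrates to zero over `[-a, a]` (no integrability needed). -/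
private theorem integral_symm_interval_eq_zero_of_odd {h : ℝ → ℝ} (hodd : ∀ x, h (-x) = -h x)
    (a : ℝ) : ∫ x in (-a)..a, h x = 0 := by
  have h1 : ∫ x in (-a)..a, h (-x) = ∫ x in (-a)..a, h x := by
    rw [intervalIntegral.integral_comp_neg, neg_neg]
  have h2 : ∫ x in (-a)..a, h (-x) = -∫ x in (-a)..a, h x := by
    simp only [hodd, intervalIntegral.integral_neg]
  linarith

/-- [folklore] An even continuous integrand over `[-a, a]` is twice its integral over `[0, a]`. -/
private theorem integral_symm_interval_eq_two_mul_of_even {h : ℝ → ℝ} (hc : Continuous h)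
    (heven : ∀ x, h (-x) = h x) (a : ℝ) :
    ∫ x in (-a)..a, h x = 2 * ∫ x in (0:ℝ)..a, h x := by
  have hi : ∀ s t : ℝ, IntervalIntegrable h volume s t := fun s t => hc.intervalIntegrable s t
  have h1 : ∫ x in (0:ℝ)..a, h (-x) = ∫ x in (-a)..0, h x := by
    rw [intervalIntegral.integral_comp_neg, neg_zero]
  simp only [heven] at h1
  rw [← intervalIntegral.integral_add_adjacent_intervals (hi (-a) 0) (hi 0 a), ← h1]
  ring

/-- [folklore] The substitution `t = x²` on `[0, a]`. -/
private theorem integral_comp_sq_mul_two_mul {G : ℝ → ℝ} (hG : Continuous G) (a : ℝ) :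
    ∫ x in (0:ℝ)..a, G (x ^ 2) * (2 * x) = ∫ t in (0:ℝ)..a ^ 2, G t := by
  have key := intervalIntegral.integral_comp_mul_deriv (a := 0) (b := a) (f := fun x : ℝ => x ^ 2)
    (f' := fun x : ℝ => 2 * x) (g := G)
    (fun x _ => by simpa using hasDerivAt_pow 2 x) (by fun_prop) hG
  simpa using key

/-! ### (2.7.6.2)–(2.7.6.4) -/

/-- **(2.7.6.2).**  For an odd continuous weighting function `w` and continuous `g`,
`∫_{-a}^{a} x w(x) g(x²) dx = ∫_0^{a²} w(√u) g(u) du` (`0 ≤ a`).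
[cite: DavisRabinowitz1984, Sect. 2.7.6 (2.7.6.2)] -/
theorem integral_mul_oddWeight_comp_sq {w g : ℝ → ℝ} (hw : Continuous w) (hodd : ∀ x, w (-x) = -w x)
    (hg : Continuous g) {a : ℝ} (ha : 0 ≤ a) :
    ∫ x in (-a)..a, x * w x * g (x ^ 2) = ∫ t in (0:ℝ)..a ^ 2, w (Real.sqrt t) * g t := by
  have heven : ∀ x, (-x) * w (-x) * g ((-x) ^ 2) = x * w x * g (x ^ 2) := fun x => by
    rw [hodd, neg_sq]; ring
  rw [integral_symm_interval_eq_two_mul_of_even (h := fun x => x * w x * g (x ^ 2)) (by fun_prop) heven]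
  have hG : Continuous fun t => w (Real.sqrt t) * g t := by fun_prop
  rw [← integral_comp_sq_mul_two_mul hG, ← intervalIntegral.integral_const_mul]
  refine intervalIntegral.integral_congr fun x hx => ?_
  rw [Set.uIcc_of_le ha] at hx
  have hs : Real.sqrt (x ^ 2) = x := Real.sqrt_sq hx.1
  simp only [hs]
  ring

/-- **(2.7.6.3), integral side.**  Odd powers: `∫_{-a}^{a} w(x) x^{2r+1} dx = ∫_0^{a²} w(√u) u^r du`.
[cite: DavisRabinowitz1984, Sect. 2.7.6 (2.7.6.3)] -/
theorem integral_oddWeight_mul_pow_odd {w : ℝ → ℝ} (hw : Continuous w) (hodd : ∀ x, w (-x) = -w x)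
    {a : ℝ} (ha : 0 ≤ a) (r : ℕ) :
    ∫ x in (-a)..a, w x * x ^ (2 * r + 1) = ∫ t in (0:ℝ)..a ^ 2, w (Real.sqrt t) * t ^ r := by
  rw [← integral_mul_oddWeight_comp_sq hw hodd (continuous_pow r) ha]
  congr 1; funext x
  rw [pow_succ, pow_mul]; ring

/-- **(2.7.6.3), rule side.**  If the `M`-point rule `(u_j, W_j)` integrates `u^r` exactly against
`w(√u)` on `[0, a²]`, then `∫_{-a}^{a} w(x) x^{2r+1} dx = Σ_j W_j u_j^r`.
[cite: DavisRabinowitz1984, Sect. 2.7.6 (2.7.6.3)] -/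
theorem integral_oddWeight_mul_pow_odd_eq_sum {w : ℝ → ℝ} (hw : Continuous w)
    (hodd : ∀ x, w (-x) = -w x) {a : ℝ} (ha : 0 ≤ a) {M : ℕ} {u W : ℕ → ℝ} {r : ℕ}
    (hex : ∫ t in (0:ℝ)..a ^ 2, w (Real.sqrt t) * t ^ r = ∑ j ∈ range M, W j * u j ^ r) :
    ∫ x in (-a)..a, w x * x ^ (2 * r + 1) = ∑ j ∈ range M, W j * u j ^ r := by
  rw [integral_oddWeight_mul_pow_odd hw hodd ha, hex]

/-- **(2.7.6.4).**  Even powers come free by symmetry: `∫_{-a}^{a} w(x) x^{2r} dx = 0` for odd `w`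
(no continuity needed).  [cite: DavisRabinowitz1984, Sect. 2.7.6 (2.7.6.4)] -/
theorem integral_oddWeight_mul_pow_even {w : ℝ → ℝ} (hodd : ∀ x, w (-x) = -w x) (a : ℝ) (r : ℕ) :
    ∫ x in (-a)..a, w x * x ^ (2 * r) = 0 :=
  integral_symm_interval_eq_zero_of_odd (h := fun x => w x * x ^ (2 * r))
    (fun x => by simp only [hodd, pow_mul, neg_sq]; ring) a

/-! ### (2.7.6.5)–(2.7.6.6): the `2M`-point rule -/

/-- **(2.7.6.6).**  The `2M`-point rule built from an `M`-point rule `(u_j, W_j)_{j<M}` on `[0, a²]`: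
nodes `x_j^* = √u_j` with weights `w_j^* = W_j / (2 √u_j)` and nodes `x_{j+M}^* = -√u_j` with weights
`w_{j+M}^* = -w_j^*`.  [cite: DavisRabinowitz1984, Sect. 2.7.6 (2.7.6.6)] -/
def oddExtensionRule (M : ℕ) (u W : ℕ → ℝ) (f : ℝ → ℝ) : ℝ :=
  ∑ j ∈ range M, W j / (2 * Real.sqrt (u j)) * f (Real.sqrt (u j)) +
    ∑ j ∈ range M, -(W j / (2 * Real.sqrt (u j))) * f (-Real.sqrt (u j))

/-- The rule (2.7.6.6) collected per pair of nodes `±√u_j`.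
[cite: DavisRabinowitz1984, Sect. 2.7.6 (2.7.6.6)] -/
theorem oddExtensionRule_eq (M : ℕ) (u W : ℕ → ℝ) (f : ℝ → ℝ) :
    oddExtensionRule M u W f =
      ∑ j ∈ range M, W j / (2 * Real.sqrt (u j)) * (f (Real.sqrt (u j)) - f (-Real.sqrt (u j))) := by
  rw [oddExtensionRule, ← sum_add_distrib]
  exact sum_congr rfl fun j _ => by ring

/-- The rule (2.7.6.6) annihilates even monomials (the rule side of (2.7.6.4)).
[cite: DavisRabinowitz1984, Sect. 2.7.6 (2.7.6.4), (2.7.6.6)] -/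
theorem oddExtensionRule_pow_even (M : ℕ) (u W : ℕ → ℝ) (r : ℕ) :
    oddExtensionRule M u W (fun x => x ^ (2 * r)) = 0 := by
  rw [oddExtensionRule_eq]
  exact sum_eq_zero fun j _ => by simp only [pow_mul, neg_sq, sub_self, mul_zero]

/-- The rule (2.7.6.6) on odd monomials: `Σ_j w_j^* (x_j^{2r+1} - (-x_j)^{2r+1}) = Σ_j W_j u_j^r`
(the rule side of (2.7.6.3); needs `u_j > 0`).
[cite: DavisRabinowitz1984, Sect. 2.7.6 (2.7.6.3), (2.7.6.6)] -/
theorem oddExtensionRule_pow_odd (M : ℕ) {u : ℕ → ℝ} (W : ℕ → ℝ) (hu : ∀ j < M, 0 < u j) (r : ℕ) :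
    oddExtensionRule M u W (fun x => x ^ (2 * r + 1)) = ∑ j ∈ range M, W j * u j ^ r := by
  rw [oddExtensionRule_eq]
  refine sum_congr rfl fun j hj => ?_
  have hj' : 0 < u j := hu j (mem_range.mp hj)
  have hne : Real.sqrt (u j) ≠ 0 := (Real.sqrt_pos.mpr hj').ne'
  have hsq : Real.sqrt (u j) ^ 2 = u j := Real.sq_sqrt hj'.le
  rw [(odd_two_mul_add_one r).neg_pow, show u j ^ r = Real.sqrt (u j) ^ (2 * r) by rw [pow_mul, hsq]]
  field_simp
  ring

/-- Linearity of the rule (2.7.6.6) in the integrand.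
[cite: DavisRabinowitz1984, Sect. 2.7.6 (2.7.6.6)] -/
theorem oddExtensionRule_finset_sum (M : ℕ) (u W : ℕ → ℝ) {ι : Type*} (s : Finset ι) (c : ι → ℝ)
    (f : ι → ℝ → ℝ) :
    oddExtensionRule M u W (fun x => ∑ i ∈ s, c i * f i x) =
      ∑ i ∈ s, c i * oddExtensionRule M u W (f i) := by
  rw [oddExtensionRule_eq]
  have key : ∀ j ∈ range M,
      W j / (2 * Real.sqrt (u j)) *
          ((∑ i ∈ s, c i * f i (Real.sqrt (u j))) - ∑ i ∈ s, c i * f i (-Real.sqrt (u j))) =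
        ∑ i ∈ s, c i * (W j / (2 * Real.sqrt (u j)) * (f i (Real.sqrt (u j)) - f i (-Real.sqrt (u j)))) := by
    intro j _
    rw [← sum_sub_distrib, mul_sum]
    exact sum_congr rfl fun i _ => by ring
  rw [sum_congr rfl key, sum_comm]
  refine sum_congr rfl fun i _ => ?_
  rw [oddExtensionRule_eq, mul_sum]

/-- **(2.7.6.5).**  Exactness on `𝒫_{4M}` with `2M` points: let `w` be continuous and odd, `0 ≤ a`,
`u_j > 0`, and let the `M`-point rule `(u_j, W_j)` integrate `u^r` exactly against `w(√u)` on `[0, a²]`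
for `0 ≤ r ≤ 2M - 1` (as an `M`-point rule of Gauss type does).  Then the `2M`-point rule (2.7.6.6)
integrates every real polynomial of degree `≤ 4M` exactly against `w` on `[-a, a]`.
[cite: DavisRabinowitz1984, Sect. 2.7.6 (2.7.6.5)] -/
theorem integral_oddWeight_mul_eval_eq_oddExtensionRule {w : ℝ → ℝ} (hw : Continuous w)
    (hodd : ∀ x, w (-x) = -w x) {a : ℝ} (ha : 0 ≤ a) (M : ℕ) {u : ℕ → ℝ} (W : ℕ → ℝ)
    (hu : ∀ j < M, 0 < u j)
    (hex : ∀ r : ℕ, r + 1 ≤ 2 * M →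
      ∫ t in (0:ℝ)..a ^ 2, w (Real.sqrt t) * t ^ r = ∑ j ∈ range M, W j * u j ^ r)
    (p : ℝ[X]) (hp : p.natDegree ≤ 4 * M) :
    ∫ x in (-a)..a, w x * p.eval x = oddExtensionRule M u W (fun x => p.eval x) := by
  have hexp : ∀ x, p.eval x = ∑ i ∈ range (4 * M + 1), p.coeff i * x ^ i := fun x =>
    eval_eq_sum_range' (Nat.lt_succ_of_le hp) x
  simp_rw [hexp]
  have hlin := oddExtensionRule_finset_sum M u W (range (4 * M + 1)) (fun i => p.coeff i)
    (fun i x => x ^ i)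
  rw [hlin]
  have hint : ∀ i : ℕ, IntervalIntegrable (fun x => w x * x ^ i) volume (-a) a := fun i =>
    (by fun_prop : Continuous fun x => w x * x ^ i).intervalIntegrable _ _
  calc ∫ x in (-a)..a, w x * ∑ i ∈ range (4 * M + 1), p.coeff i * x ^ i
      = ∫ x in (-a)..a, ∑ i ∈ range (4 * M + 1), p.coeff i * (w x * x ^ i) := by
        congr 1; funext x
        rw [mul_sum]
        exact sum_congr rfl fun i _ => by ring
    _ = ∑ i ∈ range (4 * M + 1), ∫ x in (-a)..a, p.coeff i * (w x * x ^ i) :=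
        intervalIntegral.integral_finsetSum fun i _ => (hint i).const_mul _
    _ = ∑ i ∈ range (4 * M + 1), p.coeff i * ∫ x in (-a)..a, w x * x ^ i := by
        simp only [intervalIntegral.integral_const_mul]
    _ = ∑ i ∈ range (4 * M + 1), p.coeff i * oddExtensionRule M u W (fun x => x ^ i) := by
        refine sum_congr rfl fun i hi => ?_
        congr 1
        rcases Nat.even_or_odd i with ⟨r, hr⟩ | ⟨r, hr⟩
        · rw [hr, ← two_mul, integral_oddWeight_mul_pow_even hodd, oddExtensionRule_pow_even]
        · have hr' : r + 1 ≤ 2 * M := by have := mem_range.mp hi; omega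
          rw [hr, integral_oddWeight_mul_pow_odd_eq_sum hw hodd ha (hex r hr'),
            oddExtensionRule_pow_odd M W hu]

/-- **(2.7.6.5), headline form.**  Degree of exactness `4M` with `2M` points for an odd weight.
[cite: DavisRabinowitz1984, Sect. 2.7.6 (2.7.6.5)-(2.7.6.6)] -/
theorem oddWeight_twoM_point_rule_exact {w : ℝ → ℝ} (hw : Continuous w) (hodd : ∀ x, w (-x) = -w x)
    {a : ℝ} (ha : 0 ≤ a) (M : ℕ) {u : ℕ → ℝ} (W : ℕ → ℝ) (hu : ∀ j < M, 0 < u j)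
    (hex : ∀ r : ℕ, r + 1 ≤ 2 * M →
      ∫ t in (0:ℝ)..a ^ 2, w (Real.sqrt t) * t ^ r = ∑ j ∈ range M, W j * u j ^ r) :
    ∀ p : ℝ[X], p.natDegree ≤ 4 * M →
      ∫ x in (-a)..a, w x * p.eval x =
        ∑ j ∈ range M, W j / (2 * Real.sqrt (u j)) * p.eval (Real.sqrt (u j)) +
          ∑ j ∈ range M, -(W j / (2 * Real.sqrt (u j))) * p.eval (-Real.sqrt (u j)) :=
  fun p hp => integral_oddWeight_mul_eval_eq_oddExtensionRule hw hodd ha M W hu hex p hp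

/-! ### Worked instance: `w(x) = x` on `[-1, 1]`, `M = 1` -/

/-- For `w(x) = x` on `[-1, 1]` the weight on `[0, 1]` is `√u`; its one-point Gauss rule is
`u₁ = m₁/m₀ = 3/5`, `W₁ = m₀ = 2/3`.  The resulting two-point rule (2.7.6.6) has nodes `±√(3/5)` and
weights `±(2/3)/(2√(3/5))`; it reproduces `∫_{-1}^{1} x · x dx = 2/3`.
[cite: DavisRabinowitz1984, Sect. 2.7.6 (2.7.6.5)-(2.7.6.6)] -/
theorem oddExtensionRule_linearWeight_pow_one :
    ∫ x in (-1:ℝ)..1, x * x ^ 1 = oddExtensionRule 1 (fun _ => 3 / 5) (fun _ => 2 / 3) (fun x => x ^ 1) := by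
  rw [show (fun x : ℝ => x ^ 1) = fun x => x ^ (2 * 0 + 1) from rfl,
    oddExtensionRule_pow_odd 1 (fun _ => 2 / 3) (fun _ _ => by norm_num) 0]
  have : ∫ x in (-1:ℝ)..1, x * x ^ 1 = ∫ x in (-1:ℝ)..1, x ^ 2 := by
    congr 1; funext x; ring
  rw [this, integral_pow]
  norm_num

/-- Same instance, degree three: the rule reproduces `∫_{-1}^{1} x · x³ dx = 2/5`; together with the
vanishing of both sides on even powers this is exactness on `𝒫_4 = 𝒫_{4M}`, `M = 1`.
[cite: DavisRabinowitz1984, Sect. 2.7.6 (2.7.6.5)-(2.7.6.6)] -/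
theorem oddExtensionRule_linearWeight_pow_three :
    ∫ x in (-1:ℝ)..1, x * x ^ 3 = oddExtensionRule 1 (fun _ => 3 / 5) (fun _ => 2 / 3) (fun x => x ^ 3) := by
  rw [show (fun x : ℝ => x ^ 3) = fun x => x ^ (2 * 1 + 1) from rfl,
    oddExtensionRule_pow_odd 1 (fun _ => 2 / 3) (fun _ _ => by norm_num) 1]
  have : ∫ x in (-1:ℝ)..1, x * x ^ 3 = ∫ x in (-1:ℝ)..1, x ^ 4 := by
    congr 1; funext x; ring
  rw [this, integral_pow]
  norm_num

/-- Same instance, even powers: both sides vanish on `x⁰, x², x⁴`.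
[cite: DavisRabinowitz1984, Sect. 2.7.6 (2.7.6.4), (2.7.6.6)] -/
theorem oddExtensionRule_linearWeight_pow_even (r : ℕ) :
    ∫ x in (-1:ℝ)..1, x * x ^ (2 * r) = 0 ∧
      oddExtensionRule 1 (fun _ => 3 / 5) (fun _ => 2 / 3) (fun x => x ^ (2 * r)) = 0 := by
  refine ⟨?_, oddExtensionRule_pow_even 1 _ _ r⟩
  have h := integral_oddWeight_mul_pow_even (w := fun x : ℝ => x) (fun x => rfl) 1 r
  simpa using h

end Literature.Analysis.Quadrature

end
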